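/-
[OURS · L1 W4.5(b) · EL♮(3)] SPECIMEN-Q DOWNSTAIRS — the assembly `tcDeltaPointResolvable_quartic`. [claim: Hironaka2017, status: under-review]
-/
import Summits.ResolutionOfSingularities.ResolutionOfSingularities.Theorems.EquisingularLiftEquisingularLiftNatSpecimenQuarticTcDeltaTwoStepGlobal
import Summits.ResolutionOfSingularities.ResolutionOfSingularities.Theorems.EquisingularLiftEquisingularLiftNatSpecimenQuarticTcDeltaEngine
import Literature.AlgebraicGeometry.Resolution.BlowupsExistence
import Literature.AlgebraicGeometry.Motives.VarietiesProjectiveSpaceProofs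

/-!
# [OURS · L1 W4.5(b) · EL♮(3)] SPECIMEN-Q DOWNSTAIRS — THE ASSEMBLY `tcDeltaPointResolvable_quartic`
# (crux `EquisingularLiftNatThree` = stmt-ResolutionOfSingularities-20148, line `sections3`; res-L1-w45b-lead-2 CUT 2026-08-27T08:41:07Z
# «SPECIMEN-Q DOWNSTAIRS» to res-D-pv-034 AS res-L1-s36-pv-3, confirmed res-L1-w45b-plan-1 08:44:06Z; helper `--supports`, closes
# nothing by itself — res-D-pv-029's T-INST consumes it by `exact`)

HONEST FRAMING. OURS (cell `res-hironaka`, chain w45b, slot W4.5(b)); NOT a statement of any manuscript; AI-written, weaker than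
expert review. [claim: Hironaka2017, status: under-review] is the cell's framing of the programme, not of this file.

THE THEOREM. `tcDeltaPointResolvable_quartic p hp hp2 k` is the 5th explicit hypothesis («TC-Δ point-resolvable downstairs») of
the REGISTERED stub `stub_elnat_tcDeltaPointResolution` (L/res-L1-w45b-lead-2/TARGET-T-ISO-0PLUS.lean, sha16 f6dcd08c24429701)
VERBATIM at `n := 3`, `H := (hypersurface (SpecimenQuartic.form k)).left`, `ι := (hypersurfaceι (SpecimenQuartic.form k)).left`
(the statement text below was extracted programmatically from that file with exactly these substitutions), for the quartic
`H = V(x₀²x₃² + x₁⁴ + x₂⁴) ⊂ ℙ³_k`, `k = k̄`, `char k = p ≠ 2` — the first isolated-singularity hypersurface that is NOT point-resolvable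
(two tacnodal points `[1:0:0:0]`, `[0:0:0:1]`, local equation `z² + x⁴ + y⁴`).

THE WITNESS. (TC) at `v = [0:0:0:1]` with `W := ι(H)` (so `Z₁ = e ∩ T₂ ⊆ T₂` is `Set.inter_subset_right`): `υ₁ : F₂ → ℙ³` the blow-up
at `v`, `υ₁′ : F₃ → F₂` the blow-up at `Z₁ = υ₁⁻¹{v} ∩ T₂`; then (TC) at the point `p′` of `F₃` over `v′ = [1:0:0:0]` with `W := T₃`:
`υ₂ : F₄ → F₃`, `υ₂′ : F₅ → F₄`; `F′ := F₅`, `T′ := T₅`. The closure clause is the (TC) hypothesis applied twice. Inputs: stage-0 data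
(`…TcDeltaStage`), one (TC) step through a chart (`…TcDeltaChartStep`, fed by `…TcDeltaEngine*` and `…TcDeltaAmbientCharts`), transport
of the chart `D₊(x₀)` to `F₃` along `υ₁′ ≫ υ₁` (`…TcDeltaTransport`). REGULARITY of `V(closure T₅)_red`: cover `ℙ³` by `D₊(xᵢ)`;
over `D₊(x₀)` the global two-step at `p′` (`…TcDeltaTwoStepGlobal`, from the local `…TcDeltaLocalTwoStep.isRegular_twoStep`); over
`D₊(x₃)` the two later blow-ups are isomorphisms and `Γ₃` is regular there by the two-step at `v`; over `D₊(x₁) ∪ D₊(x₂)` all four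
blow-ups are isomorphisms and `Γ₀ ≅ H` is smooth there (stub-4's `isRegularRing_quotient_fSm`).

References: Hartshorne II 2.5, 7.16, Ex. 3.2.6; Stacks 0804, 080E, 02NS; Liu 8.1; stub-4's SpecimenQuartic* files; the ten sibling
`…SpecimenQuarticTcDelta*.lean` files (p519066 p520059 p519832 p521987 p522628 p523639 p524412 p525047 p526994 p527944/p528462).
-/

set_option linter.dupNamespace false -- mandated namespace `Summit.<Summit>.<Problem>` of this single-conjunct summit

noncomputable section

open CategoryTheory CategoryTheory.Limits AlgebraicGeometry TopologicalSpace
open MvPolynomial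
open AlgebraicGeometry.Scheme.IdealSheafData
open Literature.AlgebraicGeometry.Resolution
open Literature.AlgebraicGeometry.Motives
open Summit.ResolutionOfSingularities.ResolutionOfSingularities.Theorems.EquisingularLift

namespace Summit.ResolutionOfSingularities.ResolutionOfSingularities.Cruxes.EquisingularLiftNat.Sections

namespace SpecimenQuarticTcDelta

attribute [local instance] MvPolynomial.gradedAlgebra ProjBaseChange.algebraBase

/-- `char k = p ≠ 2` gives `2 ≠ 0` in `k`. [folklore] -/
theorem two_ne_zero_of_charP (p : ℕ) (hp : p.Prime) (hp2 : p ≠ 2) (k : Type) [Field k] [CharP k p] : (2 : k) ≠ 0 := by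
  intro h
  have h' : ((2 : ℕ) : k) = 0 := by exact_mod_cast h
  rw [CharP.cast_eq_zero_iff k p 2] at h'
  exact hp2 ((Nat.prime_dvd_prime_iff_eq hp Nat.prime_two).mp h')

/-- A chart point all of whose affine coordinates vanish is not in any other standard chart. [folklore] -/
theorem chart_not_mem_range_chartι (k : Type) [Field k] (c j : Fin 4) (hj : j ≠ c)
    (q : Spec (CommRingCat.of (MvPolynomial (Fin 3) k))) (hq : ∀ m : Fin 3, (X m : MvPolynomial (Fin 3) k) ∈ q.asIdeal) :
    ProjectiveSpaceCells.chartι k 3 c q ∉ Set.range (ProjectiveSpaceCells.chartι k 3 j) := by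
  obtain ⟨m, hm⟩ := Fin.exists_succAbove_eq hj
  subst hm
  intro h
  rw [ProjectiveSpaceCells.range_chartι] at h
  have hx : (X (c.succAbove m) : MvPolynomial (Fin 4) k) ∈ (ProjectiveSpaceCells.chartι k 3 c q).asHomogeneousIdeal := by
    have h0 := ProjectiveSpaceCells.chartι_preimage_zeroLocus_X k 3 c m
    have hmem : q ∈ (ProjectiveSpaceCells.chartι k 3 c).base ⁻¹'
        ProjectiveSpectrum.zeroLocus _ {(X (c.succAbove m) : MvPolynomial (Fin (3 + 1)) k)} := by
      rw [h0]
      exact (mem_zeroLocus_singleton_iff' _ _).mpr (hq m)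
    have := (ProjectiveSpectrum.mem_zeroLocus _ _ _).mp hmem
    exact this (Set.mem_singleton _)
  exact h hx

/-- `u₀(o) ∉ D₊(x_j)` for `j ≠ 0`. [folklore] -/
theorem u0_o_not_mem_range_chartι (k : Type) [Field k] (j : Fin 4) (hj : j ≠ 0) :
    u0 k (o k) ∉ Set.range (ProjectiveSpaceCells.chartι k 3 j) :=
  chart_not_mem_range_chartι k 0 j hj (o k) (fun m => Ideal.subset_span (Set.mem_range_self m))

/-- `u₃(o) ∉ D₊(x_j)` for `j ≠ 3`. [folklore] -/
theorem u3_o_not_mem_range_chartι (k : Type) [Field k] (j : Fin 4) (hj : j ≠ 3) :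
    u3 k (o k) ∉ Set.range (ProjectiveSpaceCells.chartι k 3 j) := by
  rw [u3, Scheme.Hom.comp_apply]
  refine chart_not_mem_range_chartι k 3 j hj _ (fun m => ?_)
  rw [Spec.map_apply]
  refine (mem_zeroLocus_singleton_iff' _ _).mp ?_
  refine (mem_zeroLocus_singleton_iff' _ _).mpr ?_
  rw [PrimeSpectrum.comap_asIdeal, Ideal.mem_comap]
  change rename (Equiv.swap (0 : Fin 3) 2) (X m : MvPolynomial (Fin 3) k) ∈ PointBlowup.originIdeal 2 k
  rw [rename_X]
  exact Ideal.subset_span (Set.mem_range_self _)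

/-- `u₃(𝔸³) = D₊(x₃)`. [folklore] -/
theorem range_u3 (k : Type) [Field k] : Set.range (u3 k) = Set.range (ProjectiveSpaceCells.chartι k 3 3) := by
  rw [u3]
  change Set.range (fun q => ProjectiveSpaceCells.chartι k 3 3 (Spec.map (CommRingCat.ofHom (swapHom k)) q)) = _
  exact (Scheme.homeoOfIso (asIso (Spec.map (CommRingCat.ofHom (swapHom k))))).surjective.range_comp _

/-- Every point of `ℙ³` lies in a standard chart. [cite: Hartshorne1977, II Prop. 2.5] -/
theorem exists_mem_range_chartι (k : Type) [Field k] (y : P3 k) : ∃ i : Fin 4, y ∈ Set.range (ProjectiveSpaceCells.chartι k 3 i) := by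
  have h := Proj.iSup_basicOpen_eq_top (MvPolynomial.homogeneousSubmodule (Fin (3 + 1)) k)
    (fun i : Fin 4 => (X i : MvPolynomial (Fin (3 + 1)) k)) (ProjectiveSpace.irrelevant_le_span 3 k)
  have hy : y ∈ (⨆ i : Fin 4, Proj.basicOpen (MvPolynomial.homogeneousSubmodule (Fin (3 + 1)) k) (X i : MvPolynomial (Fin (3 + 1)) k)) := by
    rw [h]; exact Opens.mem_top y
  obtain ⟨i, hi⟩ := Opens.mem_iSup.mp hy
  exact ⟨i, by rw [ProjectiveSpaceCells.range_chartι]; exact hi⟩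

/-- `ℙ³_k` is locally Noetherian. [folklore] -/
theorem isLocallyNoetherian_P3 (k : Type) [Field k] : IsLocallyNoetherian (P3 k) :=
  @LocallyOfFiniteType.isLocallyNoetherian (P3 k) (Spec (CommRingCat.of k)) (projectiveSpace 3 k).hom
    (ProjSpace.locallyOfFiniteType_projectiveSpace_hom (N := 3) (K := k)) inferInstance

/-- `Γ₀ = V(closure ι(H))_red` is regular over `D₊(x₁)` and `D₊(x₂)` (stub-4's smooth charts). [folklore] -/
theorem isRegularLocalRing_Γ₀_far (k : Type) [Field k] [IsAlgClosed k] (h2 : (2 : k) ≠ 0) (c : Fin 4) (hc : c = 1 ∨ c = 2)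
    (x : (vanishingIdeal (⟨closure (Set.range (ιQ k)), isClosed_closure⟩ : Closeds (P3 k))).subscheme)
    (hx : (vanishingIdeal (⟨closure (Set.range (ιQ k)), isClosed_closure⟩ : Closeds (P3 k))).subschemeι x ∈
      Set.range (ProjectiveSpaceCells.chartι k 3 c)) :
    IsRegularLocalRing ((vanishingIdeal (⟨closure (Set.range (ιQ k)), isClosed_closure⟩ : Closeds (P3 k))).subscheme.presheaf.stalk x) := by
  have hu : (ProjectiveSpaceCells.chartι k 3 c) ⁻¹' Set.range (ιQ k) = PrimeSpectrum.zeroLocus {SpecimenQuartic.fSm k} := by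
    rw [preimage_chartι_range_ι]
    rcases hc with rfl | rfl
    · rw [SpecimenQuartic.dehomogenize_form_one]
    · rw [SpecimenQuartic.dehomogenize_form_two]
  have hK : (vanishingIdeal (⟨closure (Set.range (ιQ k)), isClosed_closure⟩ : Closeds (P3 k))).comap (ProjectiveSpaceCells.chartι k 3 c) =
      ofIdealTop ((Ideal.span {SpecimenQuartic.fSm k}).map (Scheme.ΓSpecIso (CommRingCat.of (MvPolynomial (Fin 3) k))).inv.hom) := by
    rw [show (⟨closure (Set.range (ιQ k)), isClosed_closure⟩ : Closeds (P3 k)) = ⟨Set.range (ιQ k), isClosed_range_ι k⟩ from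
      Closeds.ext (closure_range_ι k)]
    exact comap_vanishingIdeal_range_of_preimage k hu (SpecimenQuartic.radical_span_fSm k h2)
  haveI := SpecimenQuartic.isRegularRing_quotient_fSm k h2
  exact isRegularLocalRing_subscheme_of_chart _ (ProjectiveSpaceCells.chartι k 3 c) _ hK x hx

/-- **SPECIMEN-Q DOWNSTAIRS.** The TC-Δ downstairs closure out of `(ℙ³, 𝟙, ι(H))` for the quartic `H = V(x₀²x₃² + x₁⁴ + x₂⁴)`
(`char k = p ≠ 2`, `k = k̄`) reaches a triple with REGULAR reduced strict transform: two (TC) steps, at `[0:0:0:1]` and then at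
`[1:0:0:0]`. This is the 5th explicit hypothesis of the registered stub `stub_elnat_tcDeltaPointResolution` VERBATIM at `n := 3`,
`H := (hypersurface (SpecimenQuartic.form k)).left`, `ι := (hypersurfaceι (SpecimenQuartic.form k)).left`.
[OURS · L1 W4.5(b) · EL♮(3) · SPECIMEN-Q DOWNSTAIRS] -/
theorem tcDeltaPointResolvable_quartic (p : ℕ) (hp : p.Prime) (hp2 : p ≠ 2) (k : Type) [Field k] [CharP k p] [IsAlgClosed k] :
    ∃ (F' : AlgebraicGeometry.Scheme.{0}) (ρ' : F' ⟶ (Literature.AlgebraicGeometry.Motives.projectiveSpace 3 k).left) (T' : Set F'), (∀ Q : (∀ F₁ :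
      AlgebraicGeometry.Scheme.{0}, (F₁ ⟶ (Literature.AlgebraicGeometry.Motives.projectiveSpace 3 k).left) → Set F₁ → Prop), Q
      (Literature.AlgebraicGeometry.Motives.projectiveSpace 3 k).left (CategoryTheory.CategoryStruct.id
      (Literature.AlgebraicGeometry.Motives.projectiveSpace 3 k).left) (Set.range
      (Literature.AlgebraicGeometry.Motives.SmoothHypersurface.hypersurfaceι (SpecimenQuartic.form k)).left) → (∀ (F₁ F₂ :
      AlgebraicGeometry.Scheme.{0}) (ρ : F₁ ⟶ (Literature.AlgebraicGeometry.Motives.projectiveSpace 3 k).left) (T₁ : Set F₁) (x :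
      ↥(AlgebraicGeometry.Scheme.IdealSheafData.vanishingIdeal (⟨closure T₁, isClosed_closure⟩ : TopologicalSpace.Closeds F₁)).subscheme) (υ : F₂ ⟶
      F₁) (hx : IsClosed ({((AlgebraicGeometry.Scheme.IdealSheafData.vanishingIdeal (⟨closure T₁, isClosed_closure⟩ : TopologicalSpace.Closeds
      F₁)).subschemeι x : F₁)} : Set F₁)), Q F₁ ρ T₁ → ¬ IsRegularLocalRing ((AlgebraicGeometry.Scheme.IdealSheafData.vanishingIdeal (⟨closure T₁,
      isClosed_closure⟩ : TopologicalSpace.Closeds F₁)).subscheme.presheaf.stalk x) → IsRegularLocalRing (F₁.presheaf.stalk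
      (((AlgebraicGeometry.Scheme.IdealSheafData.vanishingIdeal (⟨closure T₁, isClosed_closure⟩ : TopologicalSpace.Closeds F₁))).subschemeι x : F₁)) →
      Literature.AlgebraicGeometry.Resolution.IsBlowup υ (AlgebraicGeometry.Scheme.IdealSheafData.vanishingIdeal
      (⟨{((AlgebraicGeometry.Scheme.IdealSheafData.vanishingIdeal (⟨closure T₁, isClosed_closure⟩ : TopologicalSpace.Closeds F₁)).subschemeι x : F₁)},
      hx⟩ : TopologicalSpace.Closeds F₁)) → Q F₂ (CategoryTheory.CategoryStruct.comp υ ρ) (closure (υ ⁻¹' (T₁ \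
      {((AlgebraicGeometry.Scheme.IdealSheafData.vanishingIdeal (⟨closure T₁, isClosed_closure⟩ : TopologicalSpace.Closeds F₁)).subschemeι x :
      F₁)})))) → (∀ (F₁ F₂ F₃ : AlgebraicGeometry.Scheme.{0}) (ρ : F₁ ⟶ (Literature.AlgebraicGeometry.Motives.projectiveSpace 3 k).left) (T₁ : Set F₁)
      (x : ↥((AlgebraicGeometry.Scheme.IdealSheafData.vanishingIdeal (⟨closure T₁, isClosed_closure⟩ : TopologicalSpace.Closeds F₁))).subscheme) (υ :
      F₂ ⟶ F₁) (hx : IsClosed ({(((AlgebraicGeometry.Scheme.IdealSheafData.vanishingIdeal (⟨closure T₁, isClosed_closure⟩ : TopologicalSpace.Closeds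
      F₁))).subschemeι x : F₁)} : Set F₁)) (W : Set F₁) (υ' : F₃ ⟶ F₂) (hZ : IsClosed (υ ⁻¹'
      {(((AlgebraicGeometry.Scheme.IdealSheafData.vanishingIdeal (⟨closure T₁, isClosed_closure⟩ : TopologicalSpace.Closeds F₁))).subschemeι x : F₁)}
      ∩ closure (υ ⁻¹' (W \ {(((AlgebraicGeometry.Scheme.IdealSheafData.vanishingIdeal (⟨closure T₁, isClosed_closure⟩ : TopologicalSpace.Closeds
      F₁))).subschemeι x : F₁)})))), Q F₁ ρ T₁ → ¬ IsRegularLocalRing (((AlgebraicGeometry.Scheme.IdealSheafData.vanishingIdeal (⟨closure T₁,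
      isClosed_closure⟩ : TopologicalSpace.Closeds F₁))).subscheme.presheaf.stalk x) → IsRegularLocalRing (F₁.presheaf.stalk
      (((AlgebraicGeometry.Scheme.IdealSheafData.vanishingIdeal (⟨closure T₁, isClosed_closure⟩ : TopologicalSpace.Closeds F₁))).subschemeι x : F₁)) →
      Literature.AlgebraicGeometry.Resolution.IsBlowup υ (AlgebraicGeometry.Scheme.IdealSheafData.vanishingIdeal
      (⟨{(((AlgebraicGeometry.Scheme.IdealSheafData.vanishingIdeal (⟨closure T₁, isClosed_closure⟩ : TopologicalSpace.Closeds F₁))).subschemeι x :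
      F₁)}, hx⟩ : TopologicalSpace.Closeds F₁)) → (((AlgebraicGeometry.Scheme.IdealSheafData.vanishingIdeal (⟨closure T₁, isClosed_closure⟩ :
      TopologicalSpace.Closeds F₁))).subschemeι x : F₁) ∈ W → ¬ (υ ⁻¹' {(((AlgebraicGeometry.Scheme.IdealSheafData.vanishingIdeal (⟨closure T₁,
      isClosed_closure⟩ : TopologicalSpace.Closeds F₁))).subschemeι x : F₁)} ⊆ closure (υ ⁻¹' (W \
      {(((AlgebraicGeometry.Scheme.IdealSheafData.vanishingIdeal (⟨closure T₁, isClosed_closure⟩ : TopologicalSpace.Closeds F₁))).subschemeι x :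
      F₁)}))) → (∃ U : F₁.affineOpens, (((AlgebraicGeometry.Scheme.IdealSheafData.vanishingIdeal (⟨closure T₁, isClosed_closure⟩ :
      TopologicalSpace.Closeds F₁))).subschemeι x : F₁) ∈ (U : F₁.Opens) ∧ ((AlgebraicGeometry.Scheme.IdealSheafData.vanishingIdeal (⟨closure W,
      isClosed_closure⟩ : TopologicalSpace.Closeds F₁)).ideal U).IsPrincipal) → (υ ⁻¹' {(((AlgebraicGeometry.Scheme.IdealSheafData.vanishingIdeal
      (⟨closure T₁, isClosed_closure⟩ : TopologicalSpace.Closeds F₁))).subschemeι x : F₁)} ∩ closure (υ ⁻¹' (W \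
      {(((AlgebraicGeometry.Scheme.IdealSheafData.vanishingIdeal (⟨closure T₁, isClosed_closure⟩ : TopologicalSpace.Closeds F₁))).subschemeι x :
      F₁)}))) ⊆ closure (υ ⁻¹' (T₁ \ {(((AlgebraicGeometry.Scheme.IdealSheafData.vanishingIdeal (⟨closure T₁, isClosed_closure⟩ :
      TopologicalSpace.Closeds F₁))).subschemeι x : F₁)})) → ¬ (closure (υ ⁻¹' (T₁ \ {(((AlgebraicGeometry.Scheme.IdealSheafData.vanishingIdeal
      (⟨closure T₁, isClosed_closure⟩ : TopologicalSpace.Closeds F₁))).subschemeι x : F₁)})) ⊆ (υ ⁻¹'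
      {(((AlgebraicGeometry.Scheme.IdealSheafData.vanishingIdeal (⟨closure T₁, isClosed_closure⟩ : TopologicalSpace.Closeds F₁))).subschemeι x : F₁)}
      ∩ closure (υ ⁻¹' (W \ {(((AlgebraicGeometry.Scheme.IdealSheafData.vanishingIdeal (⟨closure T₁, isClosed_closure⟩ : TopologicalSpace.Closeds
      F₁))).subschemeι x : F₁)})))) → Set.Finite {z : ↥((AlgebraicGeometry.Scheme.IdealSheafData.vanishingIdeal (⟨(υ ⁻¹'
      {(((AlgebraicGeometry.Scheme.IdealSheafData.vanishingIdeal (⟨closure T₁, isClosed_closure⟩ : TopologicalSpace.Closeds F₁))).subschemeι x : F₁)}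
      ∩ closure (υ ⁻¹' (W \ {(((AlgebraicGeometry.Scheme.IdealSheafData.vanishingIdeal (⟨closure T₁, isClosed_closure⟩ : TopologicalSpace.Closeds
      F₁))).subschemeι x : F₁)}))), hZ⟩ : TopologicalSpace.Closeds F₂))).subscheme | ¬ IsRegularLocalRing
      (((AlgebraicGeometry.Scheme.IdealSheafData.vanishingIdeal (⟨(υ ⁻¹' {(((AlgebraicGeometry.Scheme.IdealSheafData.vanishingIdeal (⟨closure T₁,
      isClosed_closure⟩ : TopologicalSpace.Closeds F₁))).subschemeι x : F₁)} ∩ closure (υ ⁻¹' (W \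
      {(((AlgebraicGeometry.Scheme.IdealSheafData.vanishingIdeal (⟨closure T₁, isClosed_closure⟩ : TopologicalSpace.Closeds F₁))).subschemeι x :
      F₁)}))), hZ⟩ : TopologicalSpace.Closeds F₂))).subscheme.presheaf.stalk z)} → Literature.AlgebraicGeometry.Resolution.IsBlowup υ'
      (AlgebraicGeometry.Scheme.IdealSheafData.vanishingIdeal (⟨(υ ⁻¹' {(((AlgebraicGeometry.Scheme.IdealSheafData.vanishingIdeal (⟨closure T₁,
      isClosed_closure⟩ : TopologicalSpace.Closeds F₁))).subschemeι x : F₁)} ∩ closure (υ ⁻¹' (W \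
      {(((AlgebraicGeometry.Scheme.IdealSheafData.vanishingIdeal (⟨closure T₁, isClosed_closure⟩ : TopologicalSpace.Closeds F₁))).subschemeι x :
      F₁)}))), hZ⟩ : TopologicalSpace.Closeds F₂)) → Q F₃ (CategoryTheory.CategoryStruct.comp (CategoryTheory.CategoryStruct.comp υ' υ) ρ) (closure
      (υ' ⁻¹' (closure (υ ⁻¹' (T₁ \ {(((AlgebraicGeometry.Scheme.IdealSheafData.vanishingIdeal (⟨closure T₁, isClosed_closure⟩ :
      TopologicalSpace.Closeds F₁))).subschemeι x : F₁)})) \ (υ ⁻¹' {(((AlgebraicGeometry.Scheme.IdealSheafData.vanishingIdeal (⟨closure T₁,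
      isClosed_closure⟩ : TopologicalSpace.Closeds F₁))).subschemeι x : F₁)} ∩ closure (υ ⁻¹' (W \
      {(((AlgebraicGeometry.Scheme.IdealSheafData.vanishingIdeal (⟨closure T₁, isClosed_closure⟩ : TopologicalSpace.Closeds F₁))).subschemeι x :
      F₁)}))))))) → Q F' ρ' T') ∧ Literature.AlgebraicGeometry.Resolution.Scheme.IsRegular (AlgebraicGeometry.Scheme.IdealSheafData.vanishingIdeal
      (⟨closure T', isClosed_closure⟩ : TopologicalSpace.Closeds F')).subscheme := by
  have h2 : (2 : k) ≠ 0 := two_ne_zero_of_charP p hp hp2 k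
  -- ### Stage 0: the point `x₁` of `Γ₀ = V(closure ι(H))_red` over `v = u3(o) = [0:0:0:1]`
  obtain ⟨x₁, hx₁⟩ := exists_point_Γ₀ k (preimage_u3_range_ι k)
  set v : P3 k := ((vanishingIdeal (⟨closure (Set.range (ιQ k)), isClosed_closure⟩ : Closeds (P3 k))).subschemeι x₁ : P3 k)
    with hv
  have hx₁c : IsClosed ({v} : Set (P3 k)) := by
    rw [hx₁]; exact isClosed_singleton_chart_o k (u3 k)
  have e₁ : (⟨{v}, hx₁c⟩ : Closeds (P3 k)) = ⟨{u3 k (o k)}, isClosed_singleton_chart_o k (u3 k)⟩ := Closeds.ext (by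
    change ({_} : Set (P3 k)) = {_}; rw [hx₁])
  have hux₁ : (vanishingIdeal (⟨{v}, hx₁c⟩ : Closeds (P3 k))).comap (u3 k) =
      ofIdealTop ((PointBlowup.originIdeal 2 k).map (Scheme.ΓSpecIso (CommRingCat.of (MvPolynomial (Fin 3) k))).inv.hom) := by
    rw [e₁]; exact comap_vanishingIdeal_singleton_chart_o k (u3 k)
  have huT₁ := comap_u3_vanishingIdeal_range k h2
  -- ### Step 1: blow up `ℙ³` at `v`, then `F₂` at `Z₁ = e ∩ T₂`
  obtain ⟨F₂, υ₁, hυ₁⟩ := exists_isBlowup (P3 k) (vanishingIdeal (⟨{v}, hx₁c⟩ : Closeds (P3 k)))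
  set T₂ : Set F₂ := closure (υ₁ ⁻¹' (Set.range (ιQ k) \ {v})) with hT₂
  set Z₁ : Set F₂ := υ₁ ⁻¹' {v} ∩ closure (υ₁ ⁻¹' (Set.range (ιQ k) \ {v})) with hZ₁def
  have hZ₁ : IsClosed Z₁ := isClosed_inter (T := Set.range (ιQ k)) hx₁c υ₁
  obtain ⟨F₃, υ₁', hυ₁'⟩ := exists_isBlowup F₂ (vanishingIdeal (⟨_, hZ₁⟩ : Closeds F₂))
  -- the (TC) clauses of step 1
  have c₁₆ := not_exc_subset_strict (u3 k) hx₁c hux₁ (isClosed_range_ι k) huT₁ hυ₁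
  have c₁₉ := not_strict_subset_inter (u3 k) hx₁c hux₁ (isClosed_range_ι k) huT₁ h2 hυ₁
  have c₁₁₀ := finite_nonregular_inter (u3 k) hx₁c hux₁ (isClosed_range_ι k) huT₁ h2 (hx₁ ▸ ⟨o k, rfl⟩) hυ₁
  have c₁₇ : ∃ U : (P3 k).affineOpens, v ∈ (U : (P3 k).Opens) ∧
      ((vanishingIdeal (⟨closure (Set.range (ιQ k)), isClosed_closure⟩ : Closeds (P3 k))).ideal U).IsPrincipal :=
    ⟨chartOpen (u3 k), by rw [hx₁]; exact mem_chartOpen_of_mem_range (u3 k) ⟨o k, rfl⟩,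
      isPrincipal_ideal_chartOpen (u3 k) (isClosed_range_ι k) huT₁⟩
  have c₁₂ := not_isRegularLocalRing_Γ₀ k h2 (preimage_u3_range_ι k) x₁ hx₁
  have c₁₃ : IsRegularLocalRing ((P3 k).presheaf.stalk v) := by
    rw [hx₁]; exact isRegularLocalRing_stalk_chart_o k (u3 k)
  have c₁₅ : v ∈ Set.range (ιQ k) := by
    rw [hx₁]; exact chart_o_mem_range k (preimage_u3_range_ι k)
  -- ### Notation for the sets of step 1
  set T₃ : Set F₃ := closure (υ₁' ⁻¹' (T₂ \ Z₁)) with hT₃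
  have hT₃c : IsClosed T₃ := isClosed_closure
  -- ### Transport to `F₃`: `σ = υ₁' ≫ υ₁` is an isomorphism over `D₊(x₀) = u0(Spec k[X])`
  have hvO : v ∉ Set.range (u0 k) := by rw [hx₁]; exact u3_o_not_mem_range_u0 k
  haveI iso₁ : IsIso (υ₁ ∣_ (u0 k).opensRange) := hυ₁.isIso_morphismRestrict (by
    rw [Scheme.IdealSheafData.coe_support_vanishingIdeal]
    change Disjoint (Set.range (u0 k)) {v}
    rw [Set.disjoint_singleton_right]
    exact hvO)
  haveI iso₂ : IsIso (υ₁' ∣_ (υ₁ ⁻¹ᵁ (u0 k).opensRange)) := hυ₁'.isIso_morphismRestrict (by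
    rw [Scheme.IdealSheafData.coe_support_vanishingIdeal]
    change Disjoint (υ₁ ⁻¹' Set.range (u0 k)) Z₁
    rw [Set.disjoint_left]
    rintro y hy ⟨hy1, -⟩
    exact hvO (by rw [← show υ₁ y = v from hy1]; exact hy))
  haveI iso₃ : IsIso ((υ₁' ≫ υ₁) ∣_ (u0 k).opensRange) := by
    rw [morphismRestrict_comp]; exact @IsIso.comp_isIso _ _ _ _ _ _ _ iso₂ iso₁
  have hσpre : ∀ A : Set (P3 k), (υ₁' ≫ υ₁) ⁻¹' A = υ₁' ⁻¹' (υ₁ ⁻¹' A) := fun A => by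
    ext a; simp only [Set.mem_preimage, Scheme.Hom.comp_apply]
  -- the strict transforms over `D₊(x₀)`
  have hO : IsOpen (Set.range (u0 k)) := (u0 k).isOpenEmbedding.isOpen_range
  have hint₂ : T₂ ∩ υ₁ ⁻¹' Set.range (u0 k) = υ₁ ⁻¹' Set.range (ιQ k) ∩ υ₁ ⁻¹' Set.range (u0 k) :=
    strictTransform_inter_preimage_eq υ₁ hO (isClosed_range_ι k) rfl (by
      rw [Set.singleton_inter_eq_empty]; exact hvO)
  have hint₃ : T₃ ∩ (υ₁' ≫ υ₁) ⁻¹' Set.range (u0 k) = (υ₁' ≫ υ₁) ⁻¹' (Set.range (ιQ k) ∩ Set.range (u0 k)) := by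
    rw [hσpre, hσpre, Set.preimage_inter]
    refine strictTransform_inter_preimage_eq υ₁' (hO.preimage υ₁.continuous) ((isClosed_range_ι k).preimage υ₁.continuous)
      hint₂ ?_
    rw [← Set.disjoint_iff_inter_eq_empty, Set.disjoint_left]
    rintro y ⟨hy1, -⟩ hy
    exact hvO (by rw [← show υ₁ y = v from hy1]; exact hy)
  -- the lifted chart `u₂` at `[1:0:0:0]` and its data
  set u₂ := liftChart (υ₁' ≫ υ₁) (u0 k) with hu₂
  have hc₂ : IsClosed ({u₂ (o k)} : Set F₃) := isClosed_singleton_liftChart (υ₁' ≫ υ₁) (u0 k) (isClosed_singleton_chart_o k (u0 k))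
  have hmem₂ : u₂ (o k) ∈ T₃ := liftChart_o_mem (υ₁' ≫ υ₁) (u0 k) hint₃ (chart_o_mem_range k (preimage_u0_range_ι k))
  have huT₂ : (vanishingIdeal (⟨T₃, hT₃c⟩ : Closeds F₃)).comap u₂ =
      ofIdealTop ((Ideal.span {(X 2 ^ 2 + X 0 ^ 4 + X 1 ^ 4 : MvPolynomial (Fin 3) k)}).map
        (Scheme.ΓSpecIso (CommRingCat.of (MvPolynomial (Fin 3) k))).inv.hom) :=
    (comap_liftChart_of_inter_eq (υ₁' ≫ υ₁) (u0 k) hT₃c (isClosed_range_ι k) hint₃).trans (comap_u0_vanishingIdeal_range k h2)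
  -- irreducibility of the strict transforms
  have hvne : u0 k (o k) ≠ v := fun h => hvO (h ▸ ⟨o k, rfl⟩)
  have hT₂irr : IsIrreducible T₂ :=
    isIrreducible_strictTransform_of_isBlowup ⟨{v}, hx₁c⟩ hυ₁ (isIrreducible_range_ι k h2) (fun hsub =>
      hvne (Set.mem_singleton_iff.mp (hsub (chart_o_mem_range k (preimage_u0_range_ι k)))))
  have hT₃irr : IsIrreducible T₃ := isIrreducible_strictTransform_of_isBlowup ⟨Z₁, hZ₁⟩ hυ₁' hT₂irr c₁₉
  -- the point `x'` of `Γ₃ = V(closure T₃)_red` over `p' = u₂(o)`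
  obtain ⟨x', hx'⟩ := exists_point_subscheme_of_mem u₂ hmem₂
  have hx'c : IsClosed ({((vanishingIdeal (⟨closure T₃, isClosed_closure⟩ : Closeds F₃)).subschemeι x' : F₃)} : Set F₃) := by
    rw [hx']; exact hc₂
  have e₂ : (⟨{((vanishingIdeal (⟨closure T₃, isClosed_closure⟩ : Closeds F₃)).subschemeι x' : F₃)}, hx'c⟩ : Closeds F₃) =
      ⟨{u₂ (o k)}, hc₂⟩ := Closeds.ext (by change ({_} : Set F₃) = {_}; rw [hx'])
  have hux₂ : (vanishingIdeal (⟨{((vanishingIdeal (⟨closure T₃, isClosed_closure⟩ : Closeds F₃)).subschemeι x' : F₃)}, hx'c⟩ :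
      Closeds F₃)).comap u₂ =
      ofIdealTop ((PointBlowup.originIdeal 2 k).map (Scheme.ΓSpecIso (CommRingCat.of (MvPolynomial (Fin 3) k))).inv.hom) := by
    rw [e₂]; exact comap_vanishingIdeal_singleton_chart u₂ hc₂
  -- ### Step 2: blow up `F₃` at `p'`, then `F₄` at `Z₂`
  obtain ⟨F₄, υ₂, hυ₂⟩ := exists_isBlowup F₃ (vanishingIdeal (⟨{((vanishingIdeal (⟨closure T₃, isClosed_closure⟩ :
    Closeds F₃)).subschemeι x' : F₃)}, hx'c⟩ : Closeds F₃))
  have hZ₂ := isClosed_inter (T := T₃) hx'c υ₂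
  obtain ⟨F₅, υ₂', hυ₂'⟩ := exists_isBlowup F₄ (vanishingIdeal (⟨_, hZ₂⟩ : Closeds F₄))
  have c₂₆ := not_exc_subset_strict u₂ hx'c hux₂ hT₃c huT₂ hυ₂
  have c₂₉ := not_strict_subset_inter u₂ hx'c hux₂ hT₃c huT₂ h2 hυ₂
  have c₂₁₀ := finite_nonregular_inter u₂ hx'c hux₂ hT₃c huT₂ h2 (hx' ▸ ⟨o k, rfl⟩) hυ₂
  have c₂₇ : ∃ U : F₃.affineOpens, ((vanishingIdeal (⟨closure T₃, isClosed_closure⟩ : Closeds F₃)).subschemeι x' : F₃) ∈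
      (U : F₃.Opens) ∧ ((vanishingIdeal (⟨closure T₃, isClosed_closure⟩ : Closeds F₃)).ideal U).IsPrincipal :=
    ⟨chartOpen u₂, by rw [hx']; exact mem_chartOpen_of_mem_range u₂ ⟨o k, rfl⟩, isPrincipal_ideal_chartOpen u₂ hT₃c huT₂⟩
  have c₂₂ := not_isRegularLocalRing_subscheme_of_chart u₂ hT₃c hT₃irr huT₂ x' hx'
  have c₂₃ : IsRegularLocalRing (F₃.presheaf.stalk ((vanishingIdeal (⟨closure T₃, isClosed_closure⟩ : Closeds F₃)).subschemeι x')) := by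
    rw [hx']; exact isRegularLocalRing_stalk_chart u₂
  have c₂₅ : ((vanishingIdeal (⟨closure T₃, isClosed_closure⟩ : Closeds F₃)).subschemeι x' : F₃) ∈ T₃ := by rw [hx']; exact hmem₂
  -- ### The witness
  refine ⟨F₅, (υ₂' ≫ υ₂) ≫ ((υ₁' ≫ υ₁) ≫ 𝟙 (P3 k)), closure (υ₂' ⁻¹' (closure (υ₂ ⁻¹' (T₃ \
    {((vanishingIdeal (⟨closure T₃, isClosed_closure⟩ : Closeds F₃)).subschemeι x' : F₃)})) \
    (υ₂ ⁻¹' {((vanishingIdeal (⟨closure T₃, isClosed_closure⟩ : Closeds F₃)).subschemeι x' : F₃)} ∩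
      closure (υ₂ ⁻¹' (T₃ \ {((vanishingIdeal (⟨closure T₃, isClosed_closure⟩ : Closeds F₃)).subschemeι x' : F₃)}))))),
    fun Q hbase _ hTC => ?_, ?_⟩
  · exact hTC F₃ F₄ F₅ _ T₃ x' υ₂ hx'c T₃ υ₂' hZ₂
      (hTC (P3 k) F₂ F₃ (𝟙 (P3 k)) (Set.range (ιQ k)) x₁ υ₁ hx₁c (Set.range (ιQ k)) υ₁' hZ₁ hbase c₁₂ c₁₃ hυ₁ c₁₅ c₁₆ c₁₇
        Set.inter_subset_right c₁₉ c₁₁₀ hυ₁')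
      c₂₂ c₂₃ hυ₂ c₂₅ c₂₆ c₂₇ Set.inter_subset_right c₂₉ c₂₁₀ hυ₂'
  · -- ### Final regularity of `V(closure T₅)_red`
    haveI : IsLocallyNoetherian (P3 k) := isLocallyNoetherian_P3 k
    haveI : IsLocallyNoetherian F₂ := hυ₁.isLocallyNoetherian
    haveI : IsLocallyNoetherian F₃ := hυ₁'.isLocallyNoetherian
    -- the opens of `ℙ³` and of `F₃` off the singular points
    let O₁₂ : (P3 k).Opens := (ProjectiveSpaceCells.chartι k 3 1).opensRange ⊔ (ProjectiveSpaceCells.chartι k 3 2).opensRange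
    have hmemO₁₂ : ∀ y : P3 k, y ∈ O₁₂ ↔ y ∈ Set.range (ProjectiveSpaceCells.chartι k 3 1) ∨
        y ∈ Set.range (ProjectiveSpaceCells.chartι k 3 2) := fun y => by
      change y ∈ ((_ ⊔ _ : (P3 k).Opens) : Set (P3 k)) ↔ _
      rw [Opens.coe_sup, Set.mem_union]
      exact Iff.rfl
    have hvO₁₂ : v ∉ O₁₂ := fun h => by
      rcases (hmemO₁₂ v).mp h with h | h
      · exact u3_o_not_mem_range_chartι k 1 (by decide) (hx₁ ▸ h)
      · exact u3_o_not_mem_range_chartι k 2 (by decide) (hx₁ ▸ h)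
    have hregΓ₀ : ∀ x : (vanishingIdeal (⟨closure (Set.range (ιQ k)), isClosed_closure⟩ : Closeds (P3 k))).subscheme,
        (vanishingIdeal (⟨closure (Set.range (ιQ k)), isClosed_closure⟩ : Closeds (P3 k))).subschemeι x ∈ O₁₂ →
        IsRegularLocalRing ((vanishingIdeal (⟨closure (Set.range (ιQ k)), isClosed_closure⟩ :
          Closeds (P3 k))).subscheme.presheaf.stalk x) := fun x hx => by
      rcases (hmemO₁₂ _).mp hx with h | h
      · exact isRegularLocalRing_Γ₀_far k h2 1 (Or.inl rfl) x h
      · exact isRegularLocalRing_Γ₀_far k h2 2 (Or.inr rfl) x h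
    -- step 1: `Γ₃` is regular over `D₊(x₃)` and over `D₊(x₁) ∪ D₊(x₂)`
    have reg₃ := isRegularLocalRing_twoStep_of_mem_range' (u3 k) hx₁.symm hx₁c (isClosed_range_ι k) (isIrreducible_range_ι k h2)
      huT₁ c₁₅ h2 hυ₁ hυ₁'
    have reg₃' := isRegularLocalRing_twoStep_of_mem_open' (u3 k) hx₁.symm hx₁c (isClosed_range_ι k) (isIrreducible_range_ι k h2)
      huT₁ c₁₅ h2 hυ₁ hυ₁' O₁₂ hvO₁₂ hregΓ₀
    -- step 2
    let O₃ : F₃.Opens := (υ₁' ≫ υ₁) ⁻¹ᵁ (u3 k).opensRange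
    let O₁₂' : F₃.Opens := (υ₁' ≫ υ₁) ⁻¹ᵁ O₁₂
    have hσu₂ : (υ₁' ≫ υ₁) (u₂ (o k)) = u0 k (o k) := σ_liftChart_apply (υ₁' ≫ υ₁) (u0 k) (o k)
    have hp'O₃ : ((vanishingIdeal (⟨closure T₃, isClosed_closure⟩ : Closeds F₃)).subschemeι x' : F₃) ∉ O₃ := fun h => by
      rw [hx'] at h
      change (υ₁' ≫ υ₁) (u₂ (o k)) ∈ Set.range (u3 k) at h
      rw [hσu₂] at h
      exact u0_o_not_mem_range_u3 k h
    have hp'O₁₂ : ((vanishingIdeal (⟨closure T₃, isClosed_closure⟩ : Closeds F₃)).subschemeι x' : F₃) ∉ O₁₂' := fun h => by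
      rw [hx'] at h
      change (υ₁' ≫ υ₁) (u₂ (o k)) ∈ O₁₂ at h
      rw [hσu₂] at h
      rcases (hmemO₁₂ _).mp h with h | h
      · exact u0_o_not_mem_range_chartι k 1 (by decide) h
      · exact u0_o_not_mem_range_chartι k 2 (by decide) h
    have hregO₃ : ∀ x : (vanishingIdeal (⟨closure T₃, isClosed_closure⟩ : Closeds F₃)).subscheme,
        ((vanishingIdeal (⟨closure T₃, isClosed_closure⟩ : Closeds F₃)).subschemeι x : F₃) ∈ O₃ →
        IsRegularLocalRing ((vanishingIdeal (⟨closure T₃, isClosed_closure⟩ : Closeds F₃)).subscheme.presheaf.stalk x) :=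
      fun x hx => reg₃ x (by
        change (υ₁' ≫ υ₁) _ ∈ Set.range (u3 k) at hx
        rw [Scheme.Hom.comp_apply] at hx
        exact hx)
    have hregO₁₂ : ∀ x : (vanishingIdeal (⟨closure T₃, isClosed_closure⟩ : Closeds F₃)).subscheme,
        ((vanishingIdeal (⟨closure T₃, isClosed_closure⟩ : Closeds F₃)).subschemeι x : F₃) ∈ O₁₂' →
        IsRegularLocalRing ((vanishingIdeal (⟨closure T₃, isClosed_closure⟩ : Closeds F₃)).subscheme.presheaf.stalk x) :=
      fun x hx => reg₃' x (by
        change (υ₁' ≫ υ₁) _ ∈ O₁₂ at hx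
        rw [Scheme.Hom.comp_apply] at hx
        exact hx)
    intro z
    obtain ⟨i, hi⟩ := exists_mem_range_chartι k ((υ₁' ≫ υ₁) (υ₂ (υ₂' ((vanishingIdeal (⟨closure (closure (υ₂' ⁻¹' (closure
      (υ₂ ⁻¹' (T₃ \ {((vanishingIdeal (⟨closure T₃, isClosed_closure⟩ : Closeds F₃)).subschemeι x' : F₃)})) \
      (υ₂ ⁻¹' {((vanishingIdeal (⟨closure T₃, isClosed_closure⟩ : Closeds F₃)).subschemeι x' : F₃)} ∩
      closure (υ₂ ⁻¹' (T₃ \ {((vanishingIdeal (⟨closure T₃, isClosed_closure⟩ : Closeds F₃)).subschemeι x' : F₃)})))))),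
      isClosed_closure⟩ : Closeds F₅)).subschemeι z))))
    have hi' : i = 0 ∨ i = 3 ∨ (i = 1 ∨ i = 2) := by fin_cases i <;> simp
    rcases hi' with rfl | rfl | h12
    · -- over `D₊(x₀)`: the two-step at `[1:0:0:0]`
      refine isRegularLocalRing_twoStep_of_mem_range' u₂ hx'.symm hx'c hT₃c hT₃irr huT₂ c₂₅ h2 hυ₂ hυ₂' z ?_
      rw [range_liftChart]
      exact hi
    · -- over `D₊(x₃)`: isomorphic to `Γ₃`, regular there by the two-step at `[0:0:0:1]`
      refine isRegularLocalRing_twoStep_of_mem_open' u₂ hx'.symm hx'c hT₃c hT₃irr huT₂ c₂₅ h2 hυ₂ hυ₂' O₃ hp'O₃ hregO₃ z ?_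
      change (υ₁' ≫ υ₁) _ ∈ Set.range (u3 k)
      rw [range_u3]
      exact hi
    · -- over `D₊(x₁) ∪ D₊(x₂)`: isomorphic to `Γ₀`, smooth charts
      refine isRegularLocalRing_twoStep_of_mem_open' u₂ hx'.symm hx'c hT₃c hT₃irr huT₂ c₂₅ h2 hυ₂ hυ₂' O₁₂' hp'O₁₂ hregO₁₂ z ?_
      change (υ₁' ≫ υ₁) _ ∈ O₁₂
      rw [hmemO₁₂]
      rcases h12 with rfl | rfl
      · exact Or.inl hi
      · exact Or.inr hi

end SpecimenQuarticTcDelta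

end Summit.ResolutionOfSingularities.ResolutionOfSingularities.Cruxes.EquisingularLiftNat.Sections
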